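import Summits.Ventures.HSemireg.CensusG6Verdict
import HarnessLib

/-!
# Venture HSemireg — the g = 10 OBJECT CENSUS (n = 5) of record as KERNEL DATA + its certified negative «family S, n = 5: no witness»
# (§ g = 10 ∕ FAMILY S appendix of the signed verdict): one record per row of `target-g10/CENSUS.md` §2 (custodian t-24)

HONEST FRAMING. Data + bookkeeping file of a COMPUTATION cell (`pub-hsemireg`, Sunday typer seat p11 «assembly», successor
generation; the third census file after p9's `CensusG8Table/Verdict.lean` (g = 8) and this seat's `CensusG6Table/Verdict.lean` (g = 6),
whose SCHEMA TYPES it reuses — `CensusG6.Component ∕ Kind ∕ ClassCell ∕ SigmaCell ∕ Verdict ∕ Outcome`). It TRANSCRIBES a census TABLE of OBJECTS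
AND DESIGNS the cell built and screened at named CM anchors of Weil-type abelian TENFOLDS (n = 5), and certifies by `decide` the
BOOKKEEPING behind the signed § g = 10 words: no n = 5 row — on a non-split component or on a split (ladder) component — is CLASS-EXACT ∧
W-ALIVE ∧ SEMIREGULAR; the class-live family-S skeleton ideals all fail or lack the σ half; the three non-split design rows (family-B
Kronecker ladder at n = 5) are σ-UNDECIDED; the calibrations reproduce the anchors. No variety, sheaf or map is constructed and no census
number is recomputed; every cell is the row author's word, read by p11 and published cell by cell with the census excerpts in
`run/shared/lean/pub/pub-hsemireg/p11/CENSUS-G10-LEAN-MAP.tsv`. NOTHING HERE SAYS THAT HC, HC_CM OR HC_AV IS PROVED OR REFUTED.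

SOURCE OF RECORD. `run/shared/lean/pub/pub-hsemireg/target-g10/CENSUS.md` **v1.25, sha256/16 `75d0c7e4407a9546`** (263 lines; §2 = 65 table
rows by the numbers referee's row rule — incl. ONE content-free section stub line «A23-…», transcribed as a `pointer` row with empty cells),
the hash the post-signing referee passes track («censuses g6 5d64c8087faa95c9 ∕ g8 8eb43b237c4e60ad ∕ g10 75d0c7e4407a9546», ref-4 g20);
the SIGNED verdict (`target-g6/VERDICT-G6.md` v1.0 `1651dcc7322662a2`, § g = 10 ∕ FAMILY S) cites CENSUS-g10 by its earlier hashes «or the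
successors of the custodian's 03:15Z FREEZE line»; EVERY row of v1.25 predates the signing (last new row B12n5-3, v0.98 01:18Z; custodian FREEZE after v1.15 02:32Z;
v1.16–v1.25 = POST-FREEZE ADDENDA 1–10, cells only — §5 change log), so no `signed` field is carried. Families (§0 ∕ §2 headers): A = Φ(⊠ point-ideal sheaves) and the points-case
controls at n = 5 (t-23 code A, t-24 code B), B = twisted Poincaré-type ∕ bisecant-design class searches and the family-B Kronecker ladder
rungs at n = 5, C = Markman-type SECANT objects at n = 5 (universal (1,10,20) row + control), D = objects of record before 11:27Z
(pointer rows: J(C₅) designs, theta-type sheaves, structure rows), K = calibration ∕ anchor rows (n = 1…4 reproductions, universal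
contraction ranks, frame certificates, one finite cell theorem), S = SKELETON IDEALS at n = 5 (t-23 family S: `F = I_Z ⊗ L`, `Z` a union
of translated abelian subvarieties of a FIVEFOLD; member `E = Φ(I_Z^∨ ⊠ I_{Z′})(⊗ M)` on the SPLIT (5, K) component — deciding type LADDER
only: a semiregular class-exact member would give ALL ℚ(√−d)-Weil eightfolds ∕ sixfolds ∕ fourfolds by the ladder, never a non-split
tenfold component). Columns: c1 id · c3 anchor ∕ component · c4 type · c5 CLASS · c6 EXT-PIECES · c7 SEMIREGULARITY · c8 fails at ·
c9 vacuity · c11 verdict · c12 deciding?. Fields and reading rules = `CensusG6Table.lean`'s, with n = 5 the g = 10 level (0 = several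
levels; 1…4 = calibration ∕ ladder rows), `component` from c3 + c12 (`nonsplit` = the three (5, K, a ∉ Nm) Kronecker designs; `split` =
(5, K) ladder territory incl. every family-S member; `any` = family-level statements over every (5, K, a); `none` = g ≠ 10 calibrations,
frames, the stub line), `sigma` read on the TOTAL σ (a member that is τ₁-injective but fails τ₂ by rank or count is `obstructed`;
«NOT COMPUTED ∕ UNMEASURED ∕ predicted NOT» is `undecided`), `verdict` by the leading token of c11. `scWord` ∕ `yesToken` = the numbers
referee's two regexes verbatim (here 1 ∕ 6 rows, all wording: «INSTANCE verdicts … candidate» in S24-3; «YES (door-level) ∕ YES-grade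
information» in S23-11…16 — none a both-halves row).

THE SIGNED WORDS THIS FILE TYPES (VERDICT-G6.md v1.0 § g = 10 ∕ FAMILY S, R-81 (a) words): «family S, n = 5: no witness — ×2 EXACT 8∕8 NOT
semiregular at E[2] placements; every non-torsion re-measurement of record agrees with the E[2] verdict»; CENSUS-g10 §3: «SEMIREG+CLASS at
n = 5: 0 on non-split, 0 on split (ladder) COMPUTED; candidates with both halves: 0»; red-6: «0 SEMIREG ∧ CLASS-EXACT ∧ W-ALIVE at g = 10».
References: the cell files named above (hash-pinned); [Bloch1972Semiregularity] §1 and [BuchweitzFlenner2003] (8.1) for what «semiregular»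
means in the census; nothing of either paper is used or restated here.
-/

namespace Summit.Ventures.HSemireg.CensusG10

open Summit.Ventures.HSemireg.CensusG6 (Component Kind ClassCell SigmaCell Verdict Outcome)

/-- Object family of a CENSUS (g = 10) row (the letter(s) leading the row id; §2 headers A ∕ B ∕ C ∕ D ∕ K ∕ S). [bookkeeping] -/
inductive Family | A | B | C | D | K | S
  deriving DecidableEq, Repr

/-- One table row of CENSUS (g = 10) §2; the cell types are the g = 6 census's (`CensusG6Table.lean`). [bookkeeping] -/
structure Row where
  /-- row id, census column c1 verbatim -/
  id : String
  /-- family letter(s) leading the id -/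
  family : Family
  /-- the level `n` (`g = 2n`) the row's statement is about; 5 = a g = 10 statement; 0 = several ∕ all levels -/
  n : ℕ
  /-- non-split (deciding) ∕ split (ladder) ∕ every component ∕ none -/
  component : Component
  /-- member ∕ structure row ∕ calibration ∕ all-object barrier -/
  kind : Kind
  /-- CLASS half -/
  cls : ClassCell
  /-- SEMIREGULARITY half (total σ) -/
  sigma : SigmaCell
  /-- verdict cell by leading token -/
  verdict : Verdict
  /-- c11 carries «SEMIREG+CLASS» ∕ «CANDIDATE» (numbers referee's regex) -/
  scWord : Bool
  /-- c12 carries a bare «YES» token (numbers referee's rule) -/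
  yesToken : Bool
  deriving DecidableEq, Repr

/-- **CENSUS (g = 10) §2 as kernel data**: the 65 table rows of `target-g10/CENSUS.md` v1.25 `75d0c7e4407a9546` in file order (§2.A l.22–32,
§2.B l.37–45, §2.C l.50–51, §2.D l.56–61, §2.K l.66–80, §2.S l.85–106), cells transcribed as documented above and, cell by cell with the
census excerpts, in `p11/CENSUS-G10-LEAN-MAP.tsv`. [bookkeeping; transcription — no engine number recomputed] -/
def census : List Row := [
  ⟨"A24-1", .A, 5, .split, .calibration, .dead, .injective, .semiregClassDead, false, false⟩,
  ⟨"A24-2", .A, 5, .split, .calibration, .dead, .injective, .semiregClassDead, false, false⟩,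
  ⟨"A24-3", .A, 5, .split, .calibration, .dead, .injective, .semiregClassDead, false, false⟩,
  ⟨"A23-…", .A, 5, .none, .structureRow, .none, .none, .pointer, false, false⟩,
  ⟨"A23-1", .A, 5, .any, .member, .dead, .injective, .semiregClassDead, false, false⟩,
  ⟨"A23-2", .A, 5, .any, .member, .dead, .injective, .semiregClassDead, false, false⟩,
  ⟨"A23-3", .A, 5, .any, .member, .dead, .obstructed, .classDead, false, false⟩,
  ⟨"A23-4", .A, 5, .any, .member, .dead, .obstructed, .classDead, false, false⟩,
  ⟨"A23-5", .A, 5, .any, .member, .dead, .injective, .semiregClassDead, false, false⟩,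
  ⟨"A23-6", .A, 5, .any, .member, .dead, .obstructed, .classDead, false, false⟩,
  ⟨"A23-7", .A, 5, .any, .member, .dead, .obstructed, .classDead, false, false⟩,
  ⟨"B24-1", .B, 5, .any, .structureRow, .dead, .none, .classDead, false, false⟩,
  ⟨"B24-2", .B, 4, .any, .structureRow, .dead, .none, .classDead, false, false⟩,
  ⟨"B24-3", .B, 3, .none, .structureRow, .ok, .none, .structural, false, false⟩,
  ⟨"B24-4", .B, 2, .split, .calibration, .ok, .injective, .calibration, false, false⟩,
  ⟨"B24-5", .B, 5, .any, .structureRow, .none, .none, .structural, false, false⟩,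
  ⟨"B24-6", .B, 0, .any, .structureRow, .dead, .none, .classDead, false, false⟩,
  ⟨"B12n5-1", .B, 5, .nonsplit, .structureRow, .ok, .undecided, .openOrUndecided, false, false⟩,
  ⟨"B12n5-2", .B, 5, .nonsplit, .structureRow, .ok, .undecided, .openOrUndecided, false, false⟩,
  ⟨"B12n5-3", .B, 5, .nonsplit, .structureRow, .ok, .undecided, .openOrUndecided, false, false⟩,
  ⟨"C24-1", .C, 5, .any, .structureRow, .none, .none, .openOrUndecided, false, false⟩,
  ⟨"C24-2", .C, 5, .none, .calibration, .none, .none, .calibration, false, false⟩,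
  ⟨"D24-1", .D, 5, .split, .member, .dead, .obstructed, .classDead, false, false⟩,
  ⟨"D24-2", .D, 5, .split, .member, .none, .obstructed, .notSemireg, false, false⟩,
  ⟨"D24-3", .D, 5, .split, .member, .dead, .none, .classDead, false, false⟩,
  ⟨"D24-4", .D, 5, .split, .member, .dead, .none, .classDead, false, false⟩,
  ⟨"D24-5", .D, 5, .any, .structureRow, .none, .none, .structural, false, false⟩,
  ⟨"D24-6", .D, 5, .any, .structureRow, .none, .none, .structural, false, false⟩,
  ⟨"K24-1", .K, 1, .none, .calibration, .ok, .injective, .calibration, false, false⟩,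
  ⟨"K24-2", .K, 2, .split, .calibration, .none, .injective, .calibration, false, false⟩,
  ⟨"K24-3", .K, 3, .none, .calibration, .dead, .injective, .calibration, false, false⟩,
  ⟨"K24-4", .K, 4, .none, .calibration, .dead, .injective, .calibration, false, false⟩,
  ⟨"K24-5", .K, 0, .none, .calibration, .none, .none, .calibration, false, false⟩,
  ⟨"K24-6", .K, 0, .none, .calibration, .none, .none, .calibration, false, false⟩,
  ⟨"K24-7", .K, 5, .none, .calibration, .dead, .injective, .calibration, false, false⟩,
  ⟨"K24-8", .K, 0, .none, .calibration, .none, .none, .calibration, false, false⟩,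
  ⟨"K24-9", .K, 5, .split, .structureRow, .dead, .none, .structural, false, false⟩,
  ⟨"K-A23-n1", .K, 1, .none, .calibration, .ok, .injective, .calibration, false, false⟩,
  ⟨"K-A23-n2", .K, 2, .none, .calibration, .none, .injective, .calibration, false, false⟩,
  ⟨"K-A23-n3", .K, 3, .none, .calibration, .dead, .injective, .semiregClassDead, false, false⟩,
  ⟨"K-A23-n3pt", .K, 3, .none, .calibration, .dead, .injective, .semiregClassDead, false, false⟩,
  ⟨"K-A23-n4", .K, 4, .none, .calibration, .dead, .injective, .semiregClassDead, false, false⟩,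
  ⟨"K-A23-n4pt", .K, 4, .none, .calibration, .dead, .injective, .semiregClassDead, false, false⟩,
  ⟨"S23-0", .S, 5, .any, .structureRow, .none, .none, .structural, false, false⟩,
  ⟨"S23-1", .S, 5, .split, .structureRow, .dead, .none, .classDead, false, false⟩,
  ⟨"S23-2", .S, 5, .split, .structureRow, .dead, .none, .classDead, false, false⟩,
  ⟨"S23-3", .S, 5, .split, .structureRow, .dead, .none, .classDead, false, false⟩,
  ⟨"S23-4", .S, 5, .split, .member, .ok, .obstructed, .classOkNotSemireg, false, false⟩,
  ⟨"S23-5", .S, 5, .split, .member, .ok, .obstructed, .classOkNotSemireg, false, false⟩,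
  ⟨"S23-6", .S, 5, .split, .member, .ok, .undecided, .openOrUndecided, false, false⟩,
  ⟨"S23-7", .S, 5, .split, .member, .ok, .obstructed, .classOkNotSemireg, false, false⟩,
  ⟨"S23-8", .S, 5, .split, .member, .ok, .obstructed, .classOkNotSemireg, false, false⟩,
  ⟨"S23-9", .S, 5, .any, .structureRow, .none, .none, .structural, false, false⟩,
  ⟨"S23-10", .S, 5, .split, .member, .ok, .undecided, .openOrUndecided, false, false⟩,
  ⟨"S23-11", .S, 5, .split, .member, .ok, .undecided, .openOrUndecided, false, true⟩,
  ⟨"S23-12", .S, 5, .split, .member, .ok, .obstructed, .classOkNotSemireg, false, true⟩,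
  ⟨"S23-13", .S, 5, .split, .member, .ok, .obstructed, .classOkNotSemireg, false, true⟩,
  ⟨"S23-14", .S, 5, .split, .structureRow, .none, .none, .structural, false, true⟩,
  ⟨"S23-15", .S, 5, .split, .structureRow, .ok, .none, .structural, false, true⟩,
  ⟨"S23-16", .S, 5, .any, .structureRow, .none, .none, .structural, false, true⟩,
  ⟨"S24-1", .S, 5, .split, .member, .ok, .obstructed, .classOkNotSemireg, false, false⟩,
  ⟨"S24-2", .S, 5, .split, .member, .ok, .obstructed, .classOkNotSemireg, false, false⟩,
  ⟨"S24-3", .S, 5, .split, .member, .ok, .obstructed, .classOkNotSemireg, true, false⟩,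
  ⟨"S24-4", .S, 5, .split, .member, .ok, .undecided, .openOrUndecided, false, false⟩,
  ⟨"S24-5", .S, 5, .split, .member, .ok, .undecided, .openOrUndecided, false, false⟩]

/-! ## Predicates and the three-outcome form (as in `CensusG6Verdict.lean`, at level 5) -/

/-- «SEMIREG ∧ CLASS» for a row: CLASS-EXACT ∧ W-ALIVE and total σ injective. [bookkeeping] -/
def Row.semiregAndClass (r : Row) : Bool := r.cls == .ok && r.sigma == .injective

/-- A g = 10 statement: level n = 5. [bookkeeping] -/
def Row.atFive (r : Row) : Bool := r.n == 5

/-- A DECIDING row: a g = 10 statement read on a non-split component (`nonsplit`, or a family-level `any` row). [bookkeeping] -/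
def Row.deciding (r : Row) : Bool := r.atFive && (r.component == .nonsplit || r.component == .any)

/-- A LADDER row: a g = 10 statement read on the SPLIT (5, K) component — a class-exact semiregular member there would decide every
ℚ(√−d)-Weil eightfold ∕ sixfold ∕ fourfold by the ladder («deciding type LADDER (L) only», §2.S). [bookkeeping] -/
def Row.ladder (r : Row) : Bool := r.atFive && r.component == .split

/-- The coordinator's three-outcome form on the DECIDING rows of a g = 10 table (YES-candidate ∕ STRUCTURAL-NO ∕ NO-in-families-tried),
valued in the g = 6 file's `Outcome` type. [bookkeeping] -/
def outcome (t : List Row) : Outcome :=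
  if t.any (fun r => r.deciding && r.semiregAndClass) then .yesCandidate
  else if t.any (fun r => r.deciding && r.kind == .barrierAllObjects) then .structuralNo
  else .noInFamiliesTried

/-- Number of rows satisfying a Boolean test. [bookkeeping] -/
def count (t : List Row) (p : Row → Bool) : ℕ := (t.filter p).length

/-- Ids of the rows satisfying a Boolean test, in table order. [bookkeeping] -/
def ids (t : List Row) (p : Row → Bool) : List String := (t.filter p).map Row.id

/-! ## (1) Roll-up numbers -/

/-- 65 table rows = A 11 · B 9 · C 2 · D 6 · K 15 · S 22 (the numbers referee's parse of v1.25). [bookkeeping] -/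
theorem rows_by_family :
    (census.length, count census (fun r => r.family == .A), count census (fun r => r.family == .B),
     count census (fun r => r.family == .C), count census (fun r => r.family == .D), count census (fun r => r.family == .K),
     count census (fun r => r.family == .S)) = (65, 11, 9, 2, 6, 15, 22) := by decide +kernel

/-- 48 rows are g = 10 statements (n = 5): 18 deciding (3 `nonsplit` + 15 `any`), 27 ladder (`split`), 3 `none`; the other 17 are the
n = 1…4 calibration ∕ ladder rows and the all-level rows. [bookkeeping] -/
theorem rows_at_five :
    (count census Row.atFive, count census Row.deciding, count census (fun r => r.atFive && r.component == .nonsplit),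
     count census (fun r => r.atFive && r.component == .any), count census Row.ladder,
     count census (fun r => r.atFive && r.component == .none)) = (48, 18, 3, 15, 27, 3) := by decide +kernel

/-! ## (2) The certified negative: no witness at n = 5, deciding OR ladder -/

/-- **SEMIREG ∧ CLASS = 0 at n = 5 — on the non-split components AND on the split (ladder) component** («SEMIREG+CLASS at n = 5: 0 on
non-split, 0 on split (ladder) COMPUTED»; «family S, n = 5: no witness»). [bookkeeping] -/
theorem no_semireg_and_class_at_g10 : ∀ r ∈ census, r.atFive = true → r.semiregAndClass = false := by decide +kernel

/-- The same, counted on the deciding and on the ladder rows: (0, 0). [bookkeeping] -/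
theorem semireg_and_class_counts_g10 :
    (count census (fun r => r.deciding && r.semiregAndClass), count census (fun r => r.ladder && r.semiregAndClass)) = (0, 0) := by
  decide +kernel

/-- In the WHOLE table the only both-halves rows are calibrations below n = 5: B24-4 (the n = 2 T4a member re-found by the family-B
search), K24-1 and K-A23-n1 (n = 1, «unobstructed», Weil classes = divisor classes). [bookkeeping] -/
theorem semiregAndClass_rows_all_levels :
    (census.filter Row.semiregAndClass).map (fun r => (r.id, r.n)) = [("B24-4", 2), ("K24-1", 1), ("K-A23-n1", 1)] := by
  decide +kernel

/-- **The three DECIDING rows with a class-exact ∧ W-alive cell are the family-B Kronecker-ladder designs B12n5-1 ∕ 2 ∕ 3** (non-split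
(5, ℚ(√−3), 2), (5, ℚ(√−3), 5), (5, ℚ(i), 3 ∕ 7)): σ-UNDECIDED every one (E₂-obstructed 20∕20 by theorem, «NOT-SEMIREG unless a named
d_{r≥2} value is non-zero»; no object beyond the design). [bookkeeping] -/
theorem classOk_deciding_rows_g10 :
    (census.filter fun r => r.deciding && r.cls == .ok).map (fun r => (r.id, r.sigma, r.verdict)) =
      [("B12n5-1", .undecided, .openOrUndecided), ("B12n5-2", .undecided, .openOrUndecided),
       ("B12n5-3", .undecided, .openOrUndecided)] := by decide +kernel

/-- **Every σ-injective deciding row is CLASS-DEAD** (the family-A plain ∕ point-shape members A23-1 ∕ 2 ∕ 5: MISSES-CLASS). [bookkeeping] -/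
theorem injective_deciding_rows_g10 :
    (census.filter fun r => r.deciding && r.sigma == .injective).map (fun r => (r.id, r.cls)) =
      [("A23-1", .dead), ("A23-2", .dead), ("A23-5", .dead)] := by decide +kernel

/-- **FAMILY S (the ladder territory): the class-live members all fail or lack the σ half.** The n = 5 split rows with a class-exact ∧
W-alive cell, by name with their σ cell: obstructed — Z_QI_20 (S23-4), Z_Q3_30 (S23-5), ★Z_Q3_30S (S23-7), the weighted cells (S23-8),
the M19 family (S23-12), M19C (S23-13: τ₁-injective, τ₂ fails by rank), Z_Q3_30C ∕ H8dd86315 ∕ the 99 hunt designs (S24-1 ∕ 2 ∕ 3);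
undecided — the (4,3,−3) cell (S23-6), the mixed skeleta S23-10, M19_Q3 (S23-11), the two code-B mixed cells S24-4 ∕ 5 (unmeasured);
none — the RULE-R′ balance census S23-15 (design-level). No `injective`. [bookkeeping] -/
theorem classOk_ladder_rows_g10 :
    (census.filter fun r => r.ladder && r.cls == .ok).map (fun r => (r.id, r.sigma)) =
      [("S23-4", .obstructed), ("S23-5", .obstructed), ("S23-6", .undecided), ("S23-7", .obstructed), ("S23-8", .obstructed),
       ("S23-10", .undecided), ("S23-11", .undecided), ("S23-12", .obstructed), ("S23-13", .obstructed), ("S23-15", .none),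
       ("S24-1", .obstructed), ("S24-2", .obstructed), ("S24-3", .obstructed), ("S24-4", .undecided), ("S24-5", .undecided)] ∧
    (∀ r ∈ census, r.ladder = true → r.cls = .ok → r.sigma ≠ .injective) := by decide +kernel

/-- The σ-injective ladder rows are the code-B point-ideal CONTROLS A24-1 ∕ 2 ∕ 3 (split product point), all CLASS-DEAD. [bookkeeping] -/
theorem injective_ladder_rows_g10 :
    (census.filter fun r => r.ladder && r.sigma == .injective).map (fun r => (r.id, r.cls, r.kind)) =
      [("A24-1", .dead, .calibration), ("A24-2", .dead, .calibration), ("A24-3", .dead, .calibration)] := by decide +kernel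

/-- Per family, the n = 5 rows in the verdict vocabulary (SEMIREG+CLASS · SEMIREG ∕ CLASS-DEAD · CLASS-OK ∕ NOT-SEMIREG · NOT-SEMIREG ·
CLASS-DEAD · no-object · open ∕ undecided · structural · calibration · pointer), rows A, B, C, D, K, S — 0 in the first column everywhere;
family S = 9 CLASS-OK ∕ NOT-SEMIREG + 3 CLASS-DEAD + 5 open ∕ undecided + 5 structural. [bookkeeping] -/
theorem verdict_histogram_by_family_g10 :
    (let h := fun (f : Family) (v : Verdict) => count census (fun r => r.atFive && r.family == f && r.verdict == v)
     [Family.A, .B, .C, .D, .K, .S].map fun f =>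
        [h f .semiregClass, h f .semiregClassDead, h f .classOkNotSemireg, h f .notSemireg, h f .classDead,
         h f .noObject, h f .openOrUndecided, h f .structural, h f .calibration, h f .pointer]) =
    [[0, 6, 0, 0, 4, 0, 0, 0, 0, 1],
     [0, 0, 0, 0, 1, 0, 3, 1, 0, 0],
     [0, 0, 0, 0, 0, 0, 1, 0, 1, 0],
     [0, 0, 0, 1, 3, 0, 0, 2, 0, 0],
     [0, 0, 0, 0, 0, 0, 0, 1, 1, 0],
     [0, 0, 9, 0, 3, 0, 5, 5, 0, 0]] := by decide +kernel

/-! ## (3) The referee's flags, the three-outcome form, the open rows -/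

/-- The numbers referee's two regexes fire on 1 resp. 6 rows of the g = 10 census, all WORDING (S24-3 «INSTANCE verdicts … candidate»;
S23-11…16 «YES for the mixed sub-door ∕ YES-grade information ∕ YES door-level»), none a both-halves row. [bookkeeping] -/
theorem flagged_rows_g10 :
    ids census Row.scWord = ["S24-3"] ∧
    ids census Row.yesToken = ["S23-11", "S23-12", "S23-13", "S23-14", "S23-15", "S23-16"] ∧
    (∀ r ∈ census, (r.scWord = true ∨ r.yesToken = true) → r.semiregAndClass = false) := by decide +kernel

/-- **No all-object barrier row at g = 10** (the structure rows — BOXSPLIT at n = 5, SPLIT-OBSTRUCTION, THEOREM M, THEOREM W_gen, the RULE-R′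
census, the CM-skeleton cell theorem — are family- ∕ cell-scoped). [bookkeeping] -/
theorem no_allObject_barrier_row_g10 : ids census (fun r => r.kind == .barrierAllObjects) = [] := by decide +kernel

/-- **§ g = 10 FORM on the deciding rows = «NO-in-families-tried»**, and — unlike g = 6, where split method instances exist — the ladder
rows carry no witness either: the form over ALL n = 5 rows reads the same. [bookkeeping] -/
theorem outcome_g10 :
    outcome census = .noInFamiliesTried ∧
    (if census.any (fun r => r.atFive && r.semiregAndClass) then Outcome.yesCandidate else Outcome.noInFamiliesTried) =
      Outcome.noInFamiliesTried := by decide +kernel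

/-- What WOULD flip it: one deciding n = 5 row with both halves. [bookkeeping] -/
theorem outcome_flips_on_a_deciding_yes_row_g10 (x : String) (f : Family) (k : Kind) (v : Verdict) (b₁ b₂ : Bool) :
    outcome (census ++ [Row.mk x f 5 .nonsplit k .ok .injective v b₁ b₂]) = .yesCandidate := by
  have h : (census ++ [Row.mk x f 5 .nonsplit k .ok .injective v b₁ b₂]).any (fun r => r.deciding && r.semiregAndClass) = true :=
    List.any_eq_true.mpr ⟨_, List.mem_append_right census (List.mem_singleton_self _), rfl⟩
  rw [outcome, if_pos h]

/-- The 9 open ∕ undecided n = 5 rows by name: the three non-split Kronecker designs B12n5-1 ∕ 2 ∕ 3, the hypothetical (1,10,20) secant pair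
C24-1 (no object), and the family-S cells S23-6 ∕ S23-10 ∕ S23-11 ∕ S24-4 ∕ S24-5 (σ not computed ∕ unmeasured); none has a σ number.
[bookkeeping] -/
theorem open_rows_g10 :
    ids census (fun r => r.atFive && r.verdict == .openOrUndecided) =
      ["B12n5-1", "B12n5-2", "B12n5-3", "C24-1", "S23-6", "S23-10", "S23-11", "S24-4", "S24-5"] ∧
    (∀ r ∈ census, r.verdict = .openOrUndecided → r.sigma = .undecided ∨ r.sigma = .none) := by decide +kernel

/-! ## (4) Calibrations and rows at other levels -/

/-- The anchor reproductions carried by the g = 10 census: at n = 2 the σ half of the signed 28 ∕ 18 ∕ 18 ∕ 10 is injective on both codes'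
rows (K24-2, K-A23-n2; class half cited), B24-4 re-finds the T4a member; n = 1 reads «unobstructed» (K24-1, K-A23-n1); the n = 3 ∕ 4 anchors
K24-3 ∕ 4, K-A23-n3(pt) ∕ n4(pt) are SEMIREG · CLASS-DEAD (MISSES-CLASS). [bookkeeping] -/
theorem calibration_rows_below_five :
    (census.filter fun r => !r.atFive && r.n != 0).map (fun r => (r.id, r.n, r.cls, r.sigma)) =
      [("B24-2", 4, .dead, .none), ("B24-3", 3, .ok, .none), ("B24-4", 2, .ok, .injective), ("K24-1", 1, .ok, .injective),
       ("K24-2", 2, .none, .injective), ("K24-3", 3, .dead, .injective), ("K24-4", 4, .dead, .injective),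
       ("K-A23-n1", 1, .ok, .injective), ("K-A23-n2", 2, .none, .injective), ("K-A23-n3", 3, .dead, .injective),
       ("K-A23-n3pt", 3, .dead, .injective), ("K-A23-n4", 4, .dead, .injective), ("K-A23-n4pt", 4, .dead, .injective)] := by
  decide +kernel

/-- The all-level rows (n = 0): the 2-piece family-B design search B24-6 (CLASS-DEAD at n = 3, 4, 5), the universal contraction ranks K24-5,
the n-table closed forms K24-6, the frame certificates K24-8. [bookkeeping] -/
theorem rows_all_levels : ids census (fun r => r.n == 0) = ["B24-6", "K24-5", "K24-6", "K24-8"] := by decide +kernel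

end Summit.Ventures.HSemireg.CensusG10
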